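import Summits.Ventures.PercRepro.Night2LineFair

/-!
# night-2: THE LINE THEOREM — the line income, its monotonicity, several off-line families; explicit cells (gen 38)

`lineIncome d k = Σ_{j ≤ d} C(d, j) · [5 ≤ j] · 3 / lineFaceBound (j + 2) (k + 3)` is the income of the line targets of
`basis_pair_fair_of_line` with `d` line points and `k = |Y_O|` off-line points.  It is increasing in `d`
(`C(d, j) ≤ C(d + 1, j)`, all terms nonnegative) and decreasing in `k` (`lineFaceBound` is monotone), so
**`basis_pair_fair_of_line_of_le`**: `d₀ ≤ d`, `|Y_O| ≤ k₀` and `1 ≤ lineIncome d₀ k₀` give the fair share.  Explicit cells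
(`norm_num`): `lineIncome 9 3 = 5200052091/3693505340 > 1`, `lineIncome 10 5 > 1`, `lineIncome 11 9 > 1`, `lineIncome 12 12 > 1`;
**`basis_pair_fair_of_line_plus_three`**: all of `W` but three points on a basis line with `≥ 9` further points ⇒ fair.
The line targets for two off-line sets `Y_O ≠ Y_O′` are disjoint families (`T ∩ (W ∖ ℓ) = Y_O`), so the incomes add:
**`basis_pair_fair_of_line_families`** — for a family `𝒴` of off-line sets (each `Y_O ⊆ W ∖ ℓ` with `|Y_O| ≥ 3` and
`rk (O ∖ Y_O) ≤ 1`) the pair is fair as soon as `1 ≤ Σ_{Y_O ∈ 𝒴} lineIncome d |Y_O|`.  With `𝒴 = {O} ∪ {O ∖ {y} : y ∈ O}`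
(`k = |O| ≥ 4`) the income is `lineIncome d k + k · lineIncome d (k − 1)` (**`basis_pair_fair_of_line_plus`**), which is `≥ 1`
for `d = 8, 4 ≤ k ≤ 7` and for `d = 9, 4 ≤ k ≤ 12` (`one_le_lineIncome_plus_eight_four`, `_eight_seven`, `_nine_twelve`);
**`basis_pair_fair_of_line_plus_four`**: all of `W` but four points on a basis line with `≥ 8` further points ⇒ fair.
Paper: proofs/NIGHT-2-g38.md §3.
-/

namespace PercRepro.Shadow

open PercRepro.ThmH PercRepro.PerFlat

variable {α : Type*} [DecidableEq α] {M : Matroid α} [M.Finite] {G : Finset α}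

/-- The line income: `Σ_{j ≤ d} C(d, j) · [5 ≤ j] · 3 / lineFaceBound (j + 2) (k + 3)`. -/
noncomputable def lineIncome (d k : ℕ) : ℚ :=
  ∑ j ∈ Finset.range (d + 1), ((d.choose j : ℕ) : ℚ) *
    (if 5 ≤ j then 3 / ((lineFaceBound (j + 2) (k + 3) : ℕ) : ℚ) else 0)

/-- The summand of the line income is nonnegative. -/
theorem lineIncome_term_nonneg (d j k : ℕ) :
    0 ≤ ((d.choose j : ℕ) : ℚ) * (if 5 ≤ j then 3 / ((lineFaceBound (j + 2) (k + 3) : ℕ) : ℚ) else 0) := by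
  apply mul_nonneg (by positivity)
  split_ifs
  · positivity
  · exact le_refl _

/-- The line income is increasing in `d`. -/
theorem lineIncome_le_succ (d k : ℕ) : lineIncome d k ≤ lineIncome (d + 1) k := by
  unfold lineIncome
  rw [Finset.sum_range_succ _ (d + 1)]
  refine le_trans ?_ (le_add_of_nonneg_right (lineIncome_term_nonneg (d + 1) (d + 1) k))
  apply Finset.sum_le_sum
  intro j _
  apply mul_le_mul_of_nonneg_right _ (by split_ifs <;> positivity)
  exact_mod_cast Nat.choose_le_succ d j

/-- The line income is monotone in `d`. -/
theorem lineIncome_mono_left {d₀ d : ℕ} (h : d₀ ≤ d) (k : ℕ) : lineIncome d₀ k ≤ lineIncome d k := by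
  induction h with
  | refl => exact le_refl _
  | step _ ih => exact ih.trans (lineIncome_le_succ _ k)

/-- `lineFaceBound p r > 0` for `p ≥ 1`, `r ≥ 3`. -/
theorem lineFaceBound_pos' {p r : ℕ} (hp : 1 ≤ p) (hr : 3 ≤ r) : 0 < lineFaceBound p r := by
  unfold lineFaceBound
  have := Nat.choose_pos hr
  have := Nat.mul_le_mul hp (Nat.choose_pos hr)
  omega

/-- The line income is antitone in `k`. -/
theorem lineIncome_anti_right (d : ℕ) {k k₀ : ℕ} (h : k ≤ k₀) : lineIncome d k₀ ≤ lineIncome d k := by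
  unfold lineIncome
  apply Finset.sum_le_sum
  intro j _
  apply mul_le_mul_of_nonneg_left _ (by positivity)
  split_ifs with h5
  · have hpos : (0 : ℚ) < ((lineFaceBound (j + 2) (k + 3) : ℕ) : ℚ) := by
      exact_mod_cast lineFaceBound_pos' (by omega) (by omega)
    apply div_le_div_of_nonneg_left (by norm_num) hpos
    exact_mod_cast lineFaceBound_mono (le_refl _) (by omega)
  · exact le_refl _

/-- **THE LINE THEOREM, monotone form**: `d₀ ≤ |W ∩ cl {a, b}|`, `|Y_O| ≤ k₀` and `1 ≤ lineIncome d₀ k₀` give the fair share. -/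
theorem basis_pair_fair_of_line_of_le (hG : G ∈ flatsQ M (5 + 1)) (hd : (gr M \ G).card = 2)
    (hk : kColoops M G = 1) (hs : ∀ e ∈ gr M, ∀ f ∈ gr M, e ≠ f → rkN M {e, f} = 2)
    (hl : ∀ e ∈ gr M, M.Indep {e}) (hnf : fatClosures M 5 G 2 = ∅) {B : Finset α}
    (hB : B ∈ thinMembers M 5 G) (hnP : ¬ bigP M G B) {z : α} (hz : z ∈ G \ clF M B)
    (hl0 : loss M 5 G B z ≠ 0) {a b : α} (ha : a ∈ insert z B \ coloops M G)
    (hb : b ∈ insert z B \ coloops M G) (hab : a ≠ b) {YO : Finset α}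
    (hYO : YO ⊆ (G \ insert z B) \ clF M {a, b}) (h3 : 3 ≤ YO.card)
    (hrk : rkN M (((G \ insert z B) \ clF M {a, b}) \ YO) ≤ 1) {d₀ k₀ : ℕ}
    (hd₀ : d₀ ≤ ((G \ insert z B) ∩ clF M {a, b}).card) (hk₀ : YO.card ≤ k₀) (hS : 1 ≤ lineIncome d₀ k₀) :
    loss M 5 G B z ≤ rhoL M 5 G B z * lossIncomeH M 5 G (bigP M G) (dshGT2 M 5 G) B z := by
  apply basis_pair_fair_of_line hG hd hk hs hl hnf hB hnP hz hl0 ha hb hab hYO h3 hrk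
  have h1 := lineIncome_mono_left hd₀ k₀
  have h2 := lineIncome_anti_right ((G \ insert z B) ∩ clF M {a, b}).card hk₀
  unfold lineIncome at h1 h2 hS
  linarith

/-- `lineIncome 9 3 = 5200052091 / 3693505340 ≥ 1`. -/
theorem one_le_lineIncome_nine_three : 1 ≤ lineIncome 9 3 := by
  unfold lineIncome lineFaceBound
  simp only [Finset.sum_range_succ, Finset.sum_range_zero]
  norm_num [Nat.choose]

/-- `lineIncome 10 5 ≥ 1`. -/
theorem one_le_lineIncome_ten_five : 1 ≤ lineIncome 10 5 := by
  unfold lineIncome lineFaceBound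
  simp only [Finset.sum_range_succ, Finset.sum_range_zero]
  norm_num [Nat.choose]

/-- `lineIncome 11 9 ≥ 1`. -/
theorem one_le_lineIncome_eleven_nine : 1 ≤ lineIncome 11 9 := by
  unfold lineIncome lineFaceBound
  simp only [Finset.sum_range_succ, Finset.sum_range_zero]
  norm_num [Nat.choose]

/-- `lineIncome 12 12 ≥ 1`. -/
theorem one_le_lineIncome_twelve_twelve : 1 ≤ lineIncome 12 12 := by
  unfold lineIncome lineFaceBound
  simp only [Finset.sum_range_succ, Finset.sum_range_zero]
  norm_num [Nat.choose]

/-- **The line + 3 cell**: a lossy basis pair with all of `W` but three points on a basis line carrying `≥ 9` further points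
is fair (`Y_O = W ∖ cl {a, b}`). -/
theorem basis_pair_fair_of_line_plus_three (hG : G ∈ flatsQ M (5 + 1)) (hd : (gr M \ G).card = 2)
    (hk : kColoops M G = 1) (hs : ∀ e ∈ gr M, ∀ f ∈ gr M, e ≠ f → rkN M {e, f} = 2)
    (hl : ∀ e ∈ gr M, M.Indep {e}) (hnf : fatClosures M 5 G 2 = ∅) {B : Finset α}
    (hB : B ∈ thinMembers M 5 G) (hnP : ¬ bigP M G B) {z : α} (hz : z ∈ G \ clF M B)
    (hl0 : loss M 5 G B z ≠ 0) {a b : α} (ha : a ∈ insert z B \ coloops M G)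
    (hb : b ∈ insert z B \ coloops M G) (hab : a ≠ b)
    (hoff : ((G \ insert z B) \ clF M {a, b}).card = 3)
    (hon : 9 ≤ ((G \ insert z B) ∩ clF M {a, b}).card) :
    loss M 5 G B z ≤ rhoL M 5 G B z * lossIncomeH M 5 G (bigP M G) (dshGT2 M 5 G) B z := by
  apply basis_pair_fair_of_line_of_le hG hd hk hs hl hnf hB hnP hz hl0 ha hb hab (Finset.Subset.refl _)
    hoff.ge ?_ hon hoff.le one_le_lineIncome_nine_three
  rw [Finset.sdiff_self]
  have : rkN M (∅ : Finset α) ≤ (∅ : Finset α).card := rkN_le_card _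
  rw [Finset.card_empty] at this
  omega

/-- **THE LINE THEOREM, several off-line families**: the pair is fair as soon as `1 ≤ Σ_{Y_O ∈ 𝒴} lineIncome d |Y_O|`. -/
theorem basis_pair_fair_of_line_families (hG : G ∈ flatsQ M (5 + 1)) (hd : (gr M \ G).card = 2)
    (hk : kColoops M G = 1) (hs : ∀ e ∈ gr M, ∀ f ∈ gr M, e ≠ f → rkN M {e, f} = 2)
    (hl : ∀ e ∈ gr M, M.Indep {e}) (hnf : fatClosures M 5 G 2 = ∅) {B : Finset α}
    (hB : B ∈ thinMembers M 5 G) (hnP : ¬ bigP M G B) {z : α} (hz : z ∈ G \ clF M B)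
    (hl0 : loss M 5 G B z ≠ 0) {a b : α} (ha : a ∈ insert z B \ coloops M G)
    (hb : b ∈ insert z B \ coloops M G) (hab : a ≠ b) {𝒴 : Finset (Finset α)}
    (h𝒴 : ∀ YO ∈ 𝒴, YO ⊆ (G \ insert z B) \ clF M {a, b} ∧ 3 ≤ YO.card ∧
      rkN M (((G \ insert z B) \ clF M {a, b}) \ YO) ≤ 1)
    (hsum : 1 ≤ ∑ YO ∈ 𝒴, lineIncome ((G \ insert z B) ∩ clF M {a, b}).card YO.card) :
    loss M 5 G B z ≤ rhoL M 5 G B z * lossIncomeH M 5 G (bigP M G) (dshGT2 M 5 G) B z := by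
  have hfat : (fatClosures M 5 G 2).card ≤ 1 := by
    rw [hnf, Finset.card_empty]
    exact zero_le_one
  set D : Finset α := (G \ insert z B) ∩ clF M {a, b} with hDdef
  set Ds : Finset (Finset α) := D.powerset.filter (fun YD => 5 ≤ YD.card) with hDs
  set fam : Finset α → Finset (Finset α) := fun YO => Ds.image (fun YD => insert z B ∪ (YD ∪ YO)) with hfam
  have hmemD : ∀ YD ∈ Ds, YD ⊆ D := fun YD hYD => Finset.mem_powerset.1 (Finset.mem_filter.1 hYD).1
  -- the families are pairwise disjoint: `T ∩ ((W ∖ ℓ)) = Y_O`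
  have hrec : ∀ YO ∈ 𝒴, ∀ YD ∈ Ds,
      (insert z B ∪ (YD ∪ YO)) ∩ ((G \ insert z B) \ clF M {a, b}) = YO := by
    intro YO hYO YD hYD
    obtain ⟨hYOsub, -, -⟩ := h𝒴 YO hYO
    ext x
    simp only [Finset.mem_inter, Finset.mem_union, Finset.mem_sdiff]
    constructor
    · rintro ⟨hx | hx | hx, ⟨hxG, hxQ⟩, hxl⟩
      · exact absurd hx hxQ
      · exact absurd (Finset.mem_inter.1 (hmemD YD hYD hx)).2 hxl
      · exact hx
    · intro hx
      have hx' := hYOsub hx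
      rw [Finset.mem_sdiff, Finset.mem_sdiff] at hx'
      exact ⟨Or.inr (Or.inr hx), hx'.1, hx'.2⟩
  have hdisj : (𝒴 : Set (Finset α)).PairwiseDisjoint fam := by
    intro Y₁ hY₁ Y₂ hY₂ hne
    rw [Finset.mem_coe] at hY₁ hY₂
    rw [Function.onFun, Finset.disjoint_left]
    intro T hT₁ hT₂
    rw [hfam, Finset.mem_image] at hT₁ hT₂
    obtain ⟨YD₁, hYD₁, rfl⟩ := hT₁
    obtain ⟨YD₂, hYD₂, heq⟩ := hT₂
    have h1 := hrec Y₁ hY₁ YD₁ hYD₁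
    have h2 := hrec Y₂ hY₂ YD₂ hYD₂
    rw [heq] at h2
    exact hne (h1.symm.trans h2)
  -- the union of the families
  have hsub : 𝒴.biUnion fam ⊆ tgtSets M 5 G B z := by
    apply Finset.biUnion_subset.2
    intro YO hYO
    obtain ⟨hYOsub, h3, hrk⟩ := h𝒴 YO hYO
    exact (line_targets_subset_and_income hG hd hk hs hl hnf hB hnP hz hl0 ha hb hab hYOsub h3 hrk).1
  apply basis_pair_fair_of_vCap_face_sum_subfamily hG hd hk hs hl hfat hB hnP hz hl0 hsub
  rw [Finset.sum_biUnion hdisj]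
  refine hsum.trans (Finset.sum_le_sum ?_)
  intro YO hYO
  obtain ⟨hYOsub, h3, hrk⟩ := h𝒴 YO hYO
  have h := (line_targets_subset_and_income hG hd hk hs hl hnf hB hnP hz hl0 ha hb hab hYOsub h3 hrk).2
  unfold lineIncome
  exact h

/-- **The line + `k` theorem** (`k ≥ 4`): with the families `O` and `O ∖ {y}` (`y ∈ O`), the pair is fair as soon as
`1 ≤ lineIncome d k + k · lineIncome d (k − 1)`, `d₀ ≤ d`, `k = |W ∖ cl {a, b}|`. -/
theorem basis_pair_fair_of_line_plus (hG : G ∈ flatsQ M (5 + 1)) (hd : (gr M \ G).card = 2)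
    (hk : kColoops M G = 1) (hs : ∀ e ∈ gr M, ∀ f ∈ gr M, e ≠ f → rkN M {e, f} = 2)
    (hl : ∀ e ∈ gr M, M.Indep {e}) (hnf : fatClosures M 5 G 2 = ∅) {B : Finset α}
    (hB : B ∈ thinMembers M 5 G) (hnP : ¬ bigP M G B) {z : α} (hz : z ∈ G \ clF M B)
    (hl0 : loss M 5 G B z ≠ 0) {a b : α} (ha : a ∈ insert z B \ coloops M G)
    (hb : b ∈ insert z B \ coloops M G) (hab : a ≠ b) {d₀ k : ℕ} (hk4 : 4 ≤ k)
    (hoff : ((G \ insert z B) \ clF M {a, b}).card = k)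
    (hon : d₀ ≤ ((G \ insert z B) ∩ clF M {a, b}).card)
    (hnum : 1 ≤ lineIncome d₀ k + (k : ℚ) * lineIncome d₀ (k - 1)) :
    loss M 5 G B z ≤ rhoL M 5 G B z * lossIncomeH M 5 G (bigP M G) (dshGT2 M 5 G) B z := by
  set O : Finset α := (G \ insert z B) \ clF M {a, b} with hOdef
  set 𝒴 : Finset (Finset α) := insert O (O.image (fun y => O.erase y)) with h𝒴def
  have hOnot : O ∉ O.image (fun y => O.erase y) := by
    intro h
    rw [Finset.mem_image] at h
    obtain ⟨y, hy, hey⟩ := h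
    have := Finset.card_erase_of_mem hy
    rw [hey] at this
    omega
  have hinj : Set.InjOn (fun y => O.erase y) (O : Set α) := by
    intro y₁ hy₁ y₂ hy₂ heq
    rw [Finset.mem_coe] at hy₁ hy₂
    simp only at heq
    by_contra hne
    have : y₁ ∈ O.erase y₂ := Finset.mem_erase.2 ⟨hne, hy₁⟩
    rw [← heq] at this
    exact (Finset.mem_erase.1 this).1 rfl
  apply basis_pair_fair_of_line_families hG hd hk hs hl hnf hB hnP hz hl0 ha hb hab (𝒴 := 𝒴)
  · intro YO hYO
    rw [h𝒴def, Finset.mem_insert, Finset.mem_image] at hYO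
    rcases hYO with rfl | ⟨y, hy, rfl⟩
    · refine ⟨Finset.Subset.refl _, by omega, ?_⟩
      rw [Finset.sdiff_self]
      have := rkN_le_card (M := M) (∅ : Finset α)
      rw [Finset.card_empty] at this
      omega
    · refine ⟨Finset.erase_subset _ _, ?_, ?_⟩
      · rw [Finset.card_erase_of_mem hy]
        omega
      · have hsd : O \ O.erase y = {y} := by
          ext x
          simp only [Finset.mem_sdiff, Finset.mem_erase, Finset.mem_singleton, not_and]
          constructor
          · rintro ⟨hxO, h⟩
            by_contra hxy
            exact h hxy hxO
          · rintro rfl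
            exact ⟨hy, fun h _ => h rfl⟩
        rw [hsd]
        exact le_trans (rkN_le_card _) (by simp)
  · rw [h𝒴def, Finset.sum_insert hOnot, Finset.sum_image hinj]
    have hconst : ∑ y ∈ O, lineIncome ((G \ insert z B) ∩ clF M {a, b}).card (O.erase y).card =
        (k : ℚ) * lineIncome ((G \ insert z B) ∩ clF M {a, b}).card (k - 1) := by
      rw [Finset.sum_congr rfl (fun y hy => by rw [Finset.card_erase_of_mem hy, hoff]),
        Finset.sum_const, nsmul_eq_mul, hoff]
    rw [hconst, hoff]
    have h1 := lineIncome_mono_left hon k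
    have h2 := lineIncome_mono_left hon (k - 1)
    have hk0 : (0 : ℚ) ≤ (k : ℚ) := by positivity
    nlinarith

/-- `lineIncome 8 4 + 4 · lineIncome 8 3 ≥ 1`. -/
theorem one_le_lineIncome_plus_eight_four : 1 ≤ lineIncome 8 4 + (4 : ℚ) * lineIncome 8 (4 - 1) := by
  unfold lineIncome lineFaceBound
  simp only [Finset.sum_range_succ, Finset.sum_range_zero]
  norm_num [Nat.choose]

/-- `lineIncome 8 7 + 7 · lineIncome 8 6 ≥ 1`. -/
theorem one_le_lineIncome_plus_eight_seven : 1 ≤ lineIncome 8 7 + (7 : ℚ) * lineIncome 8 (7 - 1) := by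
  unfold lineIncome lineFaceBound
  simp only [Finset.sum_range_succ, Finset.sum_range_zero]
  norm_num [Nat.choose]

/-- `lineIncome 9 12 + 12 · lineIncome 9 11 ≥ 1`. -/
theorem one_le_lineIncome_plus_nine_twelve : 1 ≤ lineIncome 9 12 + (12 : ℚ) * lineIncome 9 (12 - 1) := by
  unfold lineIncome lineFaceBound
  simp only [Finset.sum_range_succ, Finset.sum_range_zero]
  norm_num [Nat.choose]

/-- **The line + 4 cell**: all of `W` but four points on a basis line with `≥ 8` further points ⇒ fair. -/
theorem basis_pair_fair_of_line_plus_four (hG : G ∈ flatsQ M (5 + 1)) (hd : (gr M \ G).card = 2)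
    (hk : kColoops M G = 1) (hs : ∀ e ∈ gr M, ∀ f ∈ gr M, e ≠ f → rkN M {e, f} = 2)
    (hl : ∀ e ∈ gr M, M.Indep {e}) (hnf : fatClosures M 5 G 2 = ∅) {B : Finset α}
    (hB : B ∈ thinMembers M 5 G) (hnP : ¬ bigP M G B) {z : α} (hz : z ∈ G \ clF M B)
    (hl0 : loss M 5 G B z ≠ 0) {a b : α} (ha : a ∈ insert z B \ coloops M G)
    (hb : b ∈ insert z B \ coloops M G) (hab : a ≠ b)
    (hoff : ((G \ insert z B) \ clF M {a, b}).card = 4)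
    (hon : 8 ≤ ((G \ insert z B) ∩ clF M {a, b}).card) :
    loss M 5 G B z ≤ rhoL M 5 G B z * lossIncomeH M 5 G (bigP M G) (dshGT2 M 5 G) B z :=
  basis_pair_fair_of_line_plus hG hd hk hs hl hnf hB hnP hz hl0 ha hb hab (le_refl 4) hoff hon
    one_le_lineIncome_plus_eight_four


end PercRepro.Shadow

-- refresh 2026-08-29T18:1xZ: byte-identical declarations; re-filed to rebuild the dropped farm olean of p735333 (commit b39e5ac24203, OPS l.176).
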